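/-
Copyright (c) 2026. All rights reserved.
Released under Apache 2.0 license as described in the file LICENSE.
Authors: abc-iut cell, Cor. 3.12 sub-crew seat abc-iut-c312-3 (gen 9).
-/
import Literature.IUT.LogVolume.UnitLogMaxNorm
import Literature.IUT.LogVolume.LogUnitsRootTwist
import HarnessLib

/-!
# The valuation spectrum of `log_p(𝒪_K^×)` and the INNER radius in closed form:
# `‖log_p y‖ = ‖ϖ‖^{min_b (a·p^b − b·e)}` at level `a`, and `r_in = ⌊e/(p−1)⌋ + 1` whenever `(p−1) ∤ e`

Proof-only file (theorems, no definitions, no named fact), sequel of `UnitLogMaxNorm.lean` (the OUTER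
radius `max ‖log_p u‖ = ‖ϖ‖^{p^{a₀} − e·a₀}`), over abc-iut-S1's `LocalUnitLog.lean` / `RamificationInvariants.lean`
(`unitLog = log_p`, `logUnits K = log_p(𝒪_K^×)`, `e = absRamificationIdx p K`, norm uniformizer `ϖ`) and
abc-iut-w5-d017's dominant-term toolkit `LogSeriesDominantTerm.lean` (now with a general level `S = a`).
Setting: `K` ANY proper ultrametric normed `ℚ_p`-algebra field, ANY prime `p`, ANY `e ≥ 1`.

Classical content (Neukirch, *Algebraic Number Theory* II (5.5); Koblitz GTM 58 IV §1; Serre, *Local Fields*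
IV §2 for the filtration `U^{(a)}`): for a principal unit `y` of LEVEL `a ≥ 1`, i.e. `‖1 − y‖ = ‖ϖ‖^a`,
the terms of `log_p y` have norms `‖ϖ‖^{a·n − e·v_p(n)}`, whose lower envelope over `n` is

  `β_a(p, e) := min_{b ≥ 0} (a·p^b − b·e) = a·p^{a₀} − e·a₀`,

`a₀ = a₀(a)` the TURNING POINT of level `a` (`a·p^b·(p−1) < e` for `b < a₀`, `e ≤ a·p^{a₀}·(p−1)`); the
minimiser is unique with an integer gap unless `e = a·p^{a₀}·(p−1)` (a TIE at level `a`).  What is proved: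

* §1 level-`a` envelope: `exists_turning_level`; **`‖log_p y‖ ≤ ‖ϖ‖^{β_a}`** for every `y` of level
  exactly `s = a ≥ 1` (`norm_logSeries_le_zpow_level`); **`‖log_p y‖ = ‖ϖ‖^{β_a}` EXACTLY at a STRICT turning point** (`norm_logSeries_eq_zpow_level`; the term of index `p^{a₀}` dominates), attained
  by `y = 1 + ϖ^a` (`norm_unitLog_one_add_pow_eq_zpow_level`) — every `β_a` with strict turning point IS a
  valuation of `log_p(𝒪_K^×)` (`exists_mem_logUnits_norm_eq_zpow_level`).
* §2 **NO TIES when `(p−1) ∤ e`** (`lt_of_le_of_not_dvd`): then EVERY nonzero `log_p u` has norm `‖ϖ‖^{β_a}`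
  for the level `a ≥ 1` of a prime-to-`p` power of `u` (`exists_level_norm_unitLog_eq`): the VALUATION
  SPECTRUM of `log_p(𝒪_K^×) ∖ {0}` is exactly `{β_a : a ≥ 1}`.
* §3 **THE GAP BELOW `⌊e/(p−1)⌋ + 1`**: for `(p−1) ∤ e`, `β_a ≠ ⌊e/(p−1)⌋` for every level `a ≥ 1`
  (`level_envelope_ne_div`: below the critical level `β_a ≤ a·p − e < a ≤ ⌊e/(p−1)⌋`, above it `β_a = a`),
  hence **no unit has `‖log_p u‖ = ‖ϖ‖^{⌊e/(p−1)⌋}`** (`norm_unitLog_ne_zpow_div`) and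
  `{‖z‖ ≤ ‖ϖ‖^{⌊e/(p−1)⌋}} ⊄ log_p(𝒪_K^×)` (`not_closedBall_div_subset_logUnits`, witness `ϖ^{⌊e/(p−1)⌋}`);
  while `{‖z‖ ≤ ‖ϖ‖^{⌊e/(p−1)⌋+1}} ⊆ log_p(𝒪_K^×)` for EVERY `p, e` (`closedBall_div_succ_subset_logUnits`,
  abc-iut-S-lane `closedBall_subset_logUnits_of_mul_rpow_lt_one`: `(⌊e/(p−1)⌋+1)/e > 1/(p−1)`).  Together:
  **the INNER radius is `r_in = ⌊e/(p−1)⌋ + 1` EXACTLY whenever `(p−1) ∤ e`** (`innerRadius_closedForm`, in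
  the format «`closedBall 0 ‖ϖ‖^r ⊆ logUnits K ∧ ¬ closedBall 0 ‖ϖ‖^{r−1} ⊆ logUnits K`» of the R-W lane).

The excluded indices `(p−1) ∣ e` (every `e` at `p = 2`; `e = p − 1`; the layers `e = l(l−1)`, `2l(l−1)` over
`p = l`) are exactly where a tie level can occur; there the inner radius depends on `K` (tree:
`UnitLogBoundaryRamification*`, `UnitLogWildDepthTie`, `UnitLogWildDepthCyclotomic`, `UnitLogWildDyadic*`).
Consumer (D-0079 R-W lane U; record only): the per-factor INNER radii `c_i` of abc-iut-c312-5's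
`TensorPacketContentExact` (binders `hc0`/`hc`/`hmax`, discharged by `innerRadius_hyps`) / abc-iut-D1-prv's
`TensorPacketLogStarInner` and the binder `r_w` of abc-iut-w4-d036's U2 master predicate may be taken to be
`‖ϖ_w‖^{⌊e_w/(p−1)⌋+1}` at every place (`closedBall_div_succ_subset_logUnits`), OPTIMAL whenever `(p−1) ∤ e_w`.
Nothing here is disputed mathematics; no IUT statement is asserted; nothing bears on [IUTchIII] Cor. 3.12.
-/

noncomputable section

open Metric Set

namespace Literature.IUT.LogVolume

namespace LogEnvelope

open RamificationCriterion Literature.NumberTheory.GaloisRepresentations.Ultrametric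

/-! ### §1. The level-`a` envelope `β_a = min_b (a·p^b − b·e)` -/

section Arith

variable {p : ℕ} [hp : Fact p.Prime]

/-- **A turning point exists at every level `s ≥ 1`**: there is `a₀` with `s·p^b·(p−1) < e` for `b < a₀`
and `e ≤ s·p^{a₀}·(p−1)`. [cite: NeukirchANT1999, Ch. II (5.5)] -/
theorem exists_turning_level {s : ℤ} (hs : 1 ≤ s) (e : ℕ) :
    ∃ a₀ : ℕ, (∀ b < a₀, s * (p : ℤ) ^ b * ((p : ℤ) - 1) < e) ∧ (e : ℤ) ≤ s * (p : ℤ) ^ a₀ * ((p : ℤ) - 1) := by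
  classical
  have hP : (2 : ℤ) ≤ (p : ℤ) := by exact_mod_cast hp.out.two_le
  have hex : ∃ a : ℕ, (e : ℤ) ≤ s * (p : ℤ) ^ a * ((p : ℤ) - 1) := exists_le_increment hs hP e
  exact ⟨Nat.find hex, fun b hb => lt_of_not_ge (Nat.find_min hex hb), Nat.find_spec hex⟩

/-- **No ties when `(p−1) ∤ e`**: `e ≤ s·p^{a₀}·(p−1)` is strict, since equality would exhibit `p − 1` as a
divisor of `e`. [cite: NeukirchANT1999, Ch. II (5.5)] -/
theorem lt_of_le_of_not_dvd {e : ℕ} (hnd : ¬ (p - 1 ∣ e)) {s : ℤ} (hs : 1 ≤ s) {a₀ : ℕ}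
    (hhi : (e : ℤ) ≤ s * (p : ℤ) ^ a₀ * ((p : ℤ) - 1)) : (e : ℤ) < s * (p : ℤ) ^ a₀ * ((p : ℤ) - 1) := by
  have hp1 : 1 ≤ p := hp.out.one_le
  refine lt_of_le_of_ne hhi fun heq => hnd ?_
  have hs0 : 0 ≤ s := le_trans zero_le_one hs
  refine ⟨s.toNat * p ^ a₀, ?_⟩
  have h : ((e : ℕ) : ℤ) = (((p - 1) * (s.toNat * p ^ a₀) : ℕ) : ℤ) := by
    push_cast [Nat.cast_sub hp1]
    rw [Int.toNat_of_nonneg hs0, heq]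
    ring
  exact_mod_cast h

end Arith

section Field

variable (p : ℕ) [hp : Fact p.Prime]
variable {K : Type*} [NontriviallyNormedField K] [instK : NormedAlgebra ℚ_[p] K] [IsUltrametricDist K]
  [ProperSpace K]
variable {ϖ : Kˣ} (hϖ : IsUniformizer ϖ)
include hϖ

omit hϖ in
/-- **Every term exponent at level `s` dominates the level-`s` envelope**: for `s ≥ 1`, a turning point `a₀`
of level `s`, and every index `n + 1`, `s·p^{a₀} − e·a₀ ≤ s·(n+1) − e·v_p(n+1)`.
[cite: NeukirchANT1999, Ch. II (5.5)] -/
theorem envelope_le_index_level {s : ℤ} (hs : 1 ≤ s) {a₀ : ℕ}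
    (hlo : ∀ b < a₀, s * (p : ℤ) ^ b * ((p : ℤ) - 1) < absRamificationIdx p K)
    (hhi : (absRamificationIdx p K : ℤ) ≤ s * (p : ℤ) ^ a₀ * ((p : ℤ) - 1)) (n : ℕ) :
    s * (p : ℤ) ^ a₀ - (absRamificationIdx p K : ℤ) * (a₀ : ℤ)
      ≤ s * ((n + 1 : ℕ) : ℤ) - (absRamificationIdx p K : ℤ) * (padicValNat p (n + 1) : ℤ) := by
  have hP : (2 : ℤ) ≤ (p : ℤ) := by exact_mod_cast hp.out.two_le
  obtain ⟨a, ha, -⟩ := exists_exponent_le_index (p := p) hs (absRamificationIdx p K) (Nat.succ_ne_zero n)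
  exact (exponent_min (a₀ := a₀) hs hP hlo hhi a).trans ha

/-- **`‖L(y)‖ ≤ ‖ϖ‖^{s·p^{a₀} − e·a₀}` at level `s`**: if `‖1 − y‖ = ‖ϖ‖^s` (`s ≥ 1`) and `a₀` is a turning
point of level `s`. [cite: NeukirchANT1999, Ch. II (5.5)] -/
theorem norm_logSeries_le_zpow_level {s : ℤ} (hs : 1 ≤ s) {a₀ : ℕ}
    (hlo : ∀ b < a₀, s * (p : ℤ) ^ b * ((p : ℤ) - 1) < absRamificationIdx p K)
    (hhi : (absRamificationIdx p K : ℤ) ≤ s * (p : ℤ) ^ a₀ * ((p : ℤ) - 1)) {y : K}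
    (hy : ‖1 - y‖ = ‖(ϖ : K)‖ ^ s) :
    ‖logSeries y‖ ≤ ‖(ϖ : K)‖ ^ (s * (p : ℤ) ^ a₀ - (absRamificationIdx p K : ℤ) * (a₀ : ℤ)) := by
  have hρ0 : 0 < ‖(ϖ : K)‖ := norm_units_pos ϖ
  refine norm_logSeries_le (zpow_pos hρ0 _).le fun n => ?_
  rw [norm_logTerm_eq_zpow p hϖ hy n]
  exact zpow_le_zpow_right_of_le_one₀ hρ0 hϖ.1.le (envelope_le_index_level p hs hlo hhi n)

/-- **`‖L(y)‖ = ‖ϖ‖^{s·p^{a₀} − e·a₀}` EXACTLY at a STRICT turning point of level `s`** (`‖1 − y‖ = ‖ϖ‖^s`,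
`e < s·p^{a₀}·(p−1)`): the term of index `p^{a₀}` strictly dominates. [cite: NeukirchANT1999, Ch. II (5.5)] -/
theorem norm_logSeries_eq_zpow_level {s : ℤ} (hs : 1 ≤ s) {a₀ : ℕ}
    (hlo : ∀ b < a₀, s * (p : ℤ) ^ b * ((p : ℤ) - 1) < absRamificationIdx p K)
    (hhi : (absRamificationIdx p K : ℤ) < s * (p : ℤ) ^ a₀ * ((p : ℤ) - 1)) {y : K}
    (hy : ‖1 - y‖ = ‖(ϖ : K)‖ ^ s) :
    ‖logSeries y‖ = ‖(ϖ : K)‖ ^ (s * (p : ℤ) ^ a₀ - (absRamificationIdx p K : ℤ) * (a₀ : ℤ)) := by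
  have hP : (2 : ℤ) ≤ (p : ℤ) := by exact_mod_cast hp.out.two_le
  have hρ0 : 0 < ‖(ϖ : K)‖ := norm_units_pos ϖ
  have hyP : IsPrincipal y := by
    show ‖1 - y‖ < 1
    rw [hy]
    exact (zpow_lt_one_iff_right_of_lt_one₀ hρ0 hϖ.1).mpr (by omega)
  set e : ℕ := absRamificationIdx p K with he_def
  have hstrict : ∀ a : ℕ, a ≠ a₀ →
      s * (p : ℤ) ^ a₀ - e * (a₀ : ℤ) + 1 ≤ s * (p : ℤ) ^ a - e * (a : ℤ) :=
    fun a ha => exponent_min_strict (a₀ := a₀) hs hP hlo hhi ha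
  obtain ⟨n₀, hn₀1⟩ : ∃ n₀ : ℕ, n₀ + 1 = p ^ a₀ :=
    ⟨p ^ a₀ - 1, Nat.sub_add_cancel (Nat.one_le_pow _ _ hp.out.pos)⟩
  have hN₀ : s * ((n₀ + 1 : ℕ) : ℤ) - (e : ℤ) * (padicValNat p (n₀ + 1) : ℤ)
      = s * (p : ℤ) ^ a₀ - e * (a₀ : ℤ) := by
    rw [hn₀1, padicValNat.prime_pow]
    push_cast
    ring
  have hdom : ∀ n : ℕ, n ≠ n₀ → s * (p : ℤ) ^ a₀ - e * (a₀ : ℤ) + 1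
      ≤ s * ((n + 1 : ℕ) : ℤ) - (e : ℤ) * (padicValNat p (n + 1) : ℤ) := by
    intro n hn
    obtain ⟨a, ha, ha'⟩ := exists_exponent_le_index (p := p) hs e (Nat.succ_ne_zero n)
    by_cases haa : a = a₀
    · have hne : n + 1 ≠ p ^ a := by
        rw [haa, ← hn₀1]
        intro h
        exact hn (by omega)
      have h := ha' hne
      rw [haa] at h
      exact h
    · exact (hstrict a haa).trans ha
  exact norm_logSeries_eq_zpow_of_dominant p hϖ hyP hy n₀ hN₀ hdom

omit [IsUltrametricDist K] [ProperSpace K] hϖ in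
/-- `‖1 − (1 + ϖ^a)‖ = ‖ϖ‖^a`: the element `1 + ϖ^a` has level exactly `a`. [cite: NeukirchANT1999, Ch. II (5.3)] -/
theorem norm_one_sub_one_add_pow (a : ℕ) : ‖(1 : K) - (1 + (ϖ : K) ^ a)‖ = ‖(ϖ : K)‖ ^ (a : ℤ) := by
  rw [show (1 : K) - (1 + (ϖ : K) ^ a) = -((ϖ : K) ^ a) by ring, norm_neg, norm_pow, zpow_natCast]

omit [ProperSpace K] in
/-- `1 + ϖ^a` is a unit for `a ≥ 1`. [cite: NeukirchANT1999, Ch. II (5.3)] -/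
theorem norm_one_add_pow {a : ℕ} (ha : 1 ≤ a) : ‖1 + (ϖ : K) ^ a‖ = 1 := by
  have h : IsPrincipal (1 + (ϖ : K) ^ a) := by
    show ‖1 - (1 + (ϖ : K) ^ a)‖ < 1
    rw [norm_one_sub_one_add_pow (ϖ := ϖ) a, zpow_natCast]
    exact pow_lt_one₀ (norm_nonneg _) hϖ.1 (by omega)
  exact h.norm_eq_one

/-- **`‖log_p(1 + ϖ^a)‖ = ‖ϖ‖^{a·p^{a₀} − e·a₀}`** at a strict turning point of level `a ≥ 1`.
[cite: NeukirchANT1999, Ch. II (5.5)] -/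
theorem norm_unitLog_one_add_pow_eq_zpow_level {a : ℕ} (ha : 1 ≤ a) {a₀ : ℕ}
    (hlo : ∀ b < a₀, (a : ℤ) * (p : ℤ) ^ b * ((p : ℤ) - 1) < absRamificationIdx p K)
    (hhi : (absRamificationIdx p K : ℤ) < (a : ℤ) * (p : ℤ) ^ a₀ * ((p : ℤ) - 1)) :
    ‖unitLog (1 + (ϖ : K) ^ a)‖ = ‖(ϖ : K)‖ ^ ((a : ℤ) * (p : ℤ) ^ a₀ - (absRamificationIdx p K : ℤ) * (a₀ : ℤ)) := by
  have hs : (1 : ℤ) ≤ (a : ℤ) := by exact_mod_cast ha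
  have hyP : IsPrincipal (1 + (ϖ : K) ^ a) := by
    show ‖1 - (1 + (ϖ : K) ^ a)‖ < 1
    rw [norm_one_sub_one_add_pow (ϖ := ϖ) a, zpow_natCast]
    exact pow_lt_one₀ (norm_nonneg _) hϖ.1 (by omega)
  rw [unitLog_of_isPrincipal p hyP]
  exact norm_logSeries_eq_zpow_level p hϖ hs hlo hhi (norm_one_sub_one_add_pow (ϖ := ϖ) a)

/-- **Every strict level-envelope value is a valuation of `log_p(𝒪_K^×)`**: there is `z ∈ log_p(𝒪_K^×)` with
`‖z‖ = ‖ϖ‖^{a·p^{a₀} − e·a₀}` (`a ≥ 1`, strict turning point of level `a`). [cite: NeukirchANT1999, Ch. II (5.5)] -/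
theorem exists_mem_logUnits_norm_eq_zpow_level {a : ℕ} (ha : 1 ≤ a) {a₀ : ℕ}
    (hlo : ∀ b < a₀, (a : ℤ) * (p : ℤ) ^ b * ((p : ℤ) - 1) < absRamificationIdx p K)
    (hhi : (absRamificationIdx p K : ℤ) < (a : ℤ) * (p : ℤ) ^ a₀ * ((p : ℤ) - 1)) :
    ∃ z ∈ logUnits K, ‖z‖ = ‖(ϖ : K)‖ ^ ((a : ℤ) * (p : ℤ) ^ a₀ - (absRamificationIdx p K : ℤ) * (a₀ : ℤ)) :=
  ⟨unitLog (1 + (ϖ : K) ^ a), unitLog_mem_logUnits (norm_one_add_pow hϖ ha),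
    norm_unitLog_one_add_pow_eq_zpow_level p hϖ ha hlo hhi⟩

/-! ### §2. The valuation spectrum when `(p−1) ∤ e` -/

/-- **Every nonzero `L(y)` (principal `y`) has a level and the level-envelope norm**: for `(p−1) ∤ e` and a
principal unit `y ≠ 1` there are `s ≥ 1` (`‖1 − y‖ = ‖ϖ‖^s`) and a STRICT turning point `a₀` of level `s` with
`‖L(y)‖ = ‖ϖ‖^{s·p^{a₀} − e·a₀}`. [cite: NeukirchANT1999, Ch. II (5.5)] -/
theorem exists_level_norm_logSeries_eq (hnd : ¬ (p - 1 ∣ absRamificationIdx p K)) {y : K}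
    (hyP : IsPrincipal y) (hy1 : y ≠ 1) :
    ∃ s : ℤ, 1 ≤ s ∧ ‖1 - y‖ = ‖(ϖ : K)‖ ^ s ∧ ∃ a₀ : ℕ,
      (∀ b < a₀, s * (p : ℤ) ^ b * ((p : ℤ) - 1) < absRamificationIdx p K) ∧
      (absRamificationIdx p K : ℤ) < s * (p : ℤ) ^ a₀ * ((p : ℤ) - 1) ∧
      ‖logSeries y‖ = ‖(ϖ : K)‖ ^ (s * (p : ℤ) ^ a₀ - (absRamificationIdx p K : ℤ) * (a₀ : ℤ)) := by
  have hρ0 : 0 < ‖(ϖ : K)‖ := norm_units_pos ϖ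
  have hx : (1 : K) - y ≠ 0 := sub_ne_zero.mpr (Ne.symm hy1)
  obtain ⟨s, hs⟩ := hϖ.2 (Units.mk0 (1 - y) hx)
  rw [Units.val_mk0] at hs
  have hs1 : 1 ≤ s := by
    have h1 : ‖(ϖ : K)‖ ^ s < 1 := hs ▸ hyP
    have := (zpow_lt_one_iff_right_of_lt_one₀ hρ0 hϖ.1).mp h1
    omega
  obtain ⟨a₀, hlo, hhi⟩ := exists_turning_level (p := p) hs1 (absRamificationIdx p K)
  have hhi' := lt_of_le_of_not_dvd (p := p) hnd hs1 hhi
  exact ⟨s, hs1, hs, a₀, hlo, hhi', norm_logSeries_eq_zpow_level p hϖ hs1 hlo hhi' hs⟩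

/-- **The valuation spectrum of `log_p(𝒪_K^×)` for `(p−1) ∤ e`**: every `u` with `log_p u ≠ 0` has
`‖log_p u‖ = ‖ϖ‖^{s·p^{a₀} − e·a₀}` for some level `s ≥ 1` and a strict turning point `a₀` of that level (the
level of a prime-to-`p` power `u^m`, `log_p u = m⁻¹·L(u^m)`, `‖m⁻¹‖ = 1`). [cite: NeukirchANT1999, Ch. II (5.5)] -/
theorem exists_level_norm_unitLog_eq (hnd : ¬ (p - 1 ∣ absRamificationIdx p K)) {u : K}
    (hu : unitLog u ≠ 0) :
    ∃ s : ℤ, 1 ≤ s ∧ ∃ a₀ : ℕ,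
      (∀ b < a₀, s * (p : ℤ) ^ b * ((p : ℤ) - 1) < absRamificationIdx p K) ∧
      (absRamificationIdx p K : ℤ) < s * (p : ℤ) ^ a₀ * ((p : ℤ) - 1) ∧
      ‖unitLog u‖ = ‖(ϖ : K)‖ ^ (s * (p : ℤ) ^ a₀ - (absRamificationIdx p K : ℤ) * (a₀ : ℤ)) := by
  by_cases hu1 : ‖u‖ = 1
  · obtain ⟨m, hm0, hmp, hmP⟩ := exists_pow_isPrincipal_not_dvd (p := p) hu1
    have hlog : unitLog u = ((m : ℕ) : K)⁻¹ * logSeries (u ^ m) := unitLog_eq_inv_mul_logSeries p hm0 hmP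
    have hy1 : u ^ m ≠ 1 := by
      intro h1
      apply hu
      rw [hlog, h1, logSeries_one, mul_zero]
    obtain ⟨s, hs1, -, a₀, hlo, hhi, hnorm⟩ := exists_level_norm_logSeries_eq p hϖ hnd hmP hy1
    refine ⟨s, hs1, a₀, hlo, hhi, ?_⟩
    rw [hlog, norm_mul, norm_inv, norm_natCast_eq_one_of_not_dvd p hmp, inv_one, one_mul, hnorm]
  · exact absurd (unitLog_of_norm_ne_one hu1) hu

/-! ### §3. The gap below `⌊e/(p−1)⌋ + 1`: the inner radius in closed form -/

omit hϖ in
/-- **The level envelopes avoid `⌊e/(p−1)⌋`** when `(p−1) ∤ e`: for every level `s ≥ 1` and turning point `a₀`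
of that level, `s·p^{a₀} − e·a₀ ≠ ⌊e/(p−1)⌋` — below the critical level (`s·(p−1) < e`) the turning point is
`≥ 1` and `s·p^{a₀} − e·a₀ ≤ s·p − e < s ≤ ⌊e/(p−1)⌋`; above it (`s·(p−1) > e`) the turning point is `0` and the
value is `s ≥ ⌊e/(p−1)⌋ + 1`. [cite: NeukirchANT1999, Ch. II (5.5)] -/
theorem level_envelope_ne_div (hnd : ¬ (p - 1 ∣ absRamificationIdx p K)) {s : ℤ} (hs : 1 ≤ s) {a₀ : ℕ}
    (hlo : ∀ b < a₀, s * (p : ℤ) ^ b * ((p : ℤ) - 1) < absRamificationIdx p K)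
    (hhi : (absRamificationIdx p K : ℤ) ≤ s * (p : ℤ) ^ a₀ * ((p : ℤ) - 1)) :
    s * (p : ℤ) ^ a₀ - (absRamificationIdx p K : ℤ) * (a₀ : ℤ)
      ≠ ((absRamificationIdx p K / (p - 1) : ℕ) : ℤ) := by
  set e : ℕ := absRamificationIdx p K with he_def
  set g : ℕ := e / (p - 1) with hg_def
  have hP : (2 : ℤ) ≤ (p : ℤ) := by exact_mod_cast hp.out.two_le
  have hp1 : 1 ≤ p := hp.out.one_le
  have hq0 : 0 < p - 1 := by have := hp.out.two_le; omega
  -- `g·(p−1) ≤ e < (g+1)·(p−1)`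
  have hgle : ((g * (p - 1) : ℕ) : ℤ) ≤ e := by exact_mod_cast Nat.div_mul_le_self e (p - 1)
  have hglt : (e : ℤ) < ((g * (p - 1) + (p - 1) : ℕ) : ℤ) := by exact_mod_cast Nat.lt_div_mul_add hq0
  push_cast [Nat.cast_sub hp1] at hgle hglt
  -- the critical comparison `s·(p−1)` vs `e`; equality is excluded by `(p−1) ∤ e`
  have hne : s * ((p : ℤ) - 1) ≠ e := by
    intro heq
    apply hnd
    refine ⟨s.toNat, ?_⟩
    have hs0 : 0 ≤ s := by omega
    have h : ((e : ℕ) : ℤ) = (((p - 1) * s.toNat : ℕ) : ℤ) := by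
      push_cast [Nat.cast_sub hp1]
      rw [Int.toNat_of_nonneg hs0, ← heq]
      ring
    exact_mod_cast h
  rcases lt_or_gt_of_ne hne with hlt | hgt
  · -- below the critical level: `a₀ ≥ 1`, value `≤ s·p − e < s ≤ g`
    have ha₀ : a₀ ≠ 0 := by
      rintro rfl
      rw [pow_zero, mul_one] at hhi
      exact absurd hhi (not_le.mpr hlt)
    have hmin := exponent_min (a₀ := a₀) hs hP hlo hhi 1
    rw [pow_one, Nat.cast_one, mul_one] at hmin
    have hsg : s ≤ (g : ℤ) := by
      by_contra h
      rw [not_le] at h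
      have h1 : (g : ℤ) + 1 ≤ s := by omega
      have h2 : ((g : ℤ) + 1) * ((p : ℤ) - 1) ≤ s * ((p : ℤ) - 1) :=
        mul_le_mul_of_nonneg_right h1 (by linarith)
      linarith
    intro hEq
    rw [hEq] at hmin
    nlinarith
  · -- above the critical level: `a₀ = 0`, value `= s ≥ g + 1`
    have ha₀ : a₀ = 0 := by
      by_contra h
      have h0 := hlo 0 (Nat.pos_of_ne_zero h)
      rw [pow_zero, mul_one] at h0
      exact absurd h0 (not_lt.mpr hgt.le)
    subst ha₀
    rw [pow_zero, mul_one, Nat.cast_zero, mul_zero, sub_zero]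
    intro hEq
    rw [hEq] at hgt
    have : ((g : ℤ) + 1) * ((p : ℤ) - 1) ≤ (g : ℤ) * ((p : ℤ) - 1) := by nlinarith
    nlinarith

/-- **No unit has `‖log_p u‖ = ‖ϖ‖^{⌊e/(p−1)⌋}`** when `(p−1) ∤ e`. [cite: NeukirchANT1999, Ch. II (5.5)] -/
theorem norm_unitLog_ne_zpow_div (hnd : ¬ (p - 1 ∣ absRamificationIdx p K)) (u : K) :
    ‖unitLog u‖ ≠ ‖(ϖ : K)‖ ^ (((absRamificationIdx p K / (p - 1) : ℕ) : ℤ)) := by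
  have hρ0 : 0 < ‖(ϖ : K)‖ := norm_units_pos ϖ
  by_cases hu : unitLog u = 0
  · rw [hu, norm_zero]
    exact (ne_of_gt (zpow_pos hρ0 _)).symm
  · obtain ⟨s, hs1, a₀, hlo, hhi, hnorm⟩ := exists_level_norm_unitLog_eq p hϖ hnd hu
    rw [hnorm]
    intro hEq
    exact level_envelope_ne_div p hnd hs1 hlo hhi.le (zpow_right_injective₀ hρ0 hϖ.1.ne hEq)

/-- **`{‖z‖ ≤ ‖ϖ‖^{⌊e/(p−1)⌋}} ⊄ log_p(𝒪_K^×)`** when `(p−1) ∤ e`: the element `ϖ^{⌊e/(p−1)⌋}` of that ball is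
not a logarithm. [cite: NeukirchANT1999, Ch. II (5.5)] -/
theorem not_closedBall_div_subset_logUnits (hnd : ¬ (p - 1 ∣ absRamificationIdx p K)) :
    ¬ closedBall (0 : K) (‖(ϖ : K)‖ ^ (absRamificationIdx p K / (p - 1))) ⊆ logUnits K := by
  intro h
  have hmem : (ϖ : K) ^ (absRamificationIdx p K / (p - 1)) ∈
      closedBall (0 : K) (‖(ϖ : K)‖ ^ (absRamificationIdx p K / (p - 1))) := by
    rw [mem_closedBall_zero_iff, norm_pow]
  obtain ⟨u, -, hu⟩ := h hmem
  have hn : ‖unitLog u‖ = ‖(ϖ : K)‖ ^ (((absRamificationIdx p K / (p - 1) : ℕ) : ℤ)) := by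
    rw [hu, norm_pow, zpow_natCast]
  exact norm_unitLog_ne_zpow_div p hϖ hnd u hn

/-- **`{‖z‖ ≤ ‖ϖ‖^{⌊e/(p−1)⌋+1}} ⊆ log_p(𝒪_K^×)`** for EVERY `p` and `e`: `(⌊e/(p−1)⌋+1)/e > 1/(p−1)`, so the
radius is inside the successive-approximation range of abc-iut-S-lane's `closedBall_subset_logUnits_of_mul_rpow_lt_one`
(Neukirch II (5.5): `log_p` maps `U^{(n)}` onto `𝔭ⁿ` for `n > e/(p−1)`). [cite: NeukirchANT1999, Ch. II (5.5)] -/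
theorem closedBall_div_succ_subset_logUnits :
    closedBall (0 : K) (‖(ϖ : K)‖ ^ (absRamificationIdx p K / (p - 1) + 1)) ⊆ logUnits K := by
  set e : ℕ := absRamificationIdx p K with he_def
  set g : ℕ := e / (p - 1) with hg_def
  have hp1 : (1 : ℝ) < p := by exact_mod_cast hp.out.one_lt
  have hp0 : (0 : ℝ) < p := by linarith
  have hq0 : 0 < p - 1 := by have := hp.out.two_le; omega
  have he0 : (0 : ℝ) < e := by exact_mod_cast absRamificationIdx_pos p K
  -- `e < (g+1)·(p−1)` as real numbers
  have hlt : (e : ℝ) < ((g : ℝ) + 1) * ((p : ℝ) - 1) := by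
    have h := Nat.lt_div_mul_add (a := e) hq0
    have h' : (e : ℝ) < ((g * (p - 1) + (p - 1) : ℕ) : ℝ) := by exact_mod_cast h
    push_cast [Nat.cast_sub hp.out.one_le] at h'
    linarith
  refine closedBall_subset_logUnits_of_mul_rpow_lt_one p ?_
  rw [← Real.rpow_natCast, norm_eq_rpow_of_isUniformizer p K hϖ, ← Real.rpow_mul hp0.le, ← Real.rpow_add hp0]
  refine Real.rpow_lt_one_of_one_lt_of_neg hp1 ?_
  -- the exponent `−(g+1)/e + 1/(p−1)` is negative
  have hpe : (0 : ℝ) < (p : ℝ) - 1 := by linarith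
  have key : (1 : ℝ) / ((p : ℝ) - 1) < ((g : ℝ) + 1) / (e : ℝ) := by
    rw [div_lt_div_iff₀ hpe he0]
    linarith
  have hrw : ((g : ℝ) + 1) / (e : ℝ) = 1 / (e : ℝ) * ((g : ℝ) + 1) := by ring
  push_cast
  linarith [key, hrw]

/-- **THE INNER RADIUS IN CLOSED FORM: `r_in = ⌊e/(p−1)⌋ + 1` whenever `(p−1) ∤ e`** — in the format of the
R-W lane: `closedBall 0 ‖ϖ‖^r ⊆ log_p(𝒪_K^×)` and `¬ closedBall 0 ‖ϖ‖^{r−1} ⊆ log_p(𝒪_K^×)` with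
`r = ⌊e/(p−1)⌋ + 1`. [cite: NeukirchANT1999, Ch. II (5.5)] -/
theorem innerRadius_closedForm (hnd : ¬ (p - 1 ∣ absRamificationIdx p K)) :
    closedBall (0 : K) (‖(ϖ : K)‖ ^ (absRamificationIdx p K / (p - 1) + 1)) ⊆ logUnits K ∧
      ¬ closedBall (0 : K) (‖(ϖ : K)‖ ^ (absRamificationIdx p K / (p - 1))) ⊆ logUnits K :=
  ⟨closedBall_div_succ_subset_logUnits p hϖ, not_closedBall_div_subset_logUnits p hϖ hnd⟩

/-- **A ball `{‖z‖ ≤ ‖ϖ‖^n}` lies in `log_p(𝒪_K^×)` iff `n ≥ ⌊e/(p−1)⌋ + 1`** when `(p−1) ∤ e` (`n : ℕ`).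
[cite: NeukirchANT1999, Ch. II (5.5)] -/
theorem closedBall_pow_subset_logUnits_iff (hnd : ¬ (p - 1 ∣ absRamificationIdx p K)) (n : ℕ) :
    closedBall (0 : K) (‖(ϖ : K)‖ ^ n) ⊆ logUnits K ↔ absRamificationIdx p K / (p - 1) + 1 ≤ n := by
  have hρ0 : 0 < ‖(ϖ : K)‖ := norm_units_pos ϖ
  constructor
  · intro h
    by_contra hlt
    rw [not_le] at hlt
    have hsub : closedBall (0 : K) (‖(ϖ : K)‖ ^ (absRamificationIdx p K / (p - 1))) ⊆
        closedBall (0 : K) (‖(ϖ : K)‖ ^ n) :=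
      closedBall_subset_closedBall (pow_le_pow_of_le_one hρ0.le hϖ.1.le (by omega))
    exact not_closedBall_div_subset_logUnits p hϖ hnd (hsub.trans h)
  · intro hle
    exact (closedBall_subset_closedBall (pow_le_pow_of_le_one hρ0.le hϖ.1.le hle)).trans
      (closedBall_div_succ_subset_logUnits p hϖ)

/-- **The inner-radius binders of abc-iut-c312-5's exact content criterion, DISCHARGED off `(p−1) ∣ e`**:
`c := ϖ^{⌊e/(p−1)⌋+1}` is nonzero, `c·R ⊆ log_p(𝒪_K^×)`, and `w := ϖ^{⌊e/(p−1)⌋} ∉ log_p(𝒪_K^×)` satisfies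
`‖w‖·‖ϖ‖ ≤ ‖c‖` — the hypotheses `hc0` / `hc` / `hmax` of `smul_normalizedPacket_subset_logPacket_iff`
(`TensorPacketContentExact`) at this factor, so `ρ_in = ‖ϖ‖^{⌊e/(p−1)⌋+1}` there. [cite: NeukirchANT1999, Ch. II (5.5)] -/
theorem innerRadius_hyps (hnd : ¬ (p - 1 ∣ absRamificationIdx p K)) :
    (ϖ : K) ^ (absRamificationIdx p K / (p - 1) + 1) ≠ 0 ∧
      (∀ o : K, ‖o‖ ≤ 1 → (ϖ : K) ^ (absRamificationIdx p K / (p - 1) + 1) * o ∈ logUnits K) ∧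
      ∃ (ϖ' : Kˣ) (w : K), IsUniformizer ϖ' ∧ w ∉ logUnits K ∧
        ‖w‖ * ‖(ϖ' : K)‖ ≤ ‖(ϖ : K) ^ (absRamificationIdx p K / (p - 1) + 1)‖ := by
  refine ⟨pow_ne_zero _ ϖ.ne_zero, fun o ho => ?_,
    ⟨ϖ, (ϖ : K) ^ (absRamificationIdx p K / (p - 1)), hϖ, ?_, le_of_eq ?_⟩⟩
  · refine closedBall_div_succ_subset_logUnits p hϖ ?_
    rw [mem_closedBall_zero_iff, norm_mul, norm_pow]
    exact mul_le_of_le_one_right (pow_nonneg (norm_nonneg _) _) ho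
  · rintro ⟨u, -, hu⟩
    refine norm_unitLog_ne_zpow_div p hϖ hnd u ?_
    rw [hu, norm_pow, zpow_natCast]
  · rw [norm_pow, norm_pow, pow_succ]

end Field

end LogEnvelope

end Literature.IUT.LogVolume

end
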